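import Summits.RiemannHypothesis.RiemannHypothesis.Theorems.Splittings.LiRephasingMovingCutPrelim
import HarnessLib

/-!
# LI B18 KERNEL Q6/6 — THE MOVING-CUT SCHEDULE; `theoremA_infty_PL`, **`rephasing_kills_lowPhaseLaw`** (SketchG16B §9, ll.1428–1637) — RH-FREE

PRE-CUT (not filed).  Lane (xi-q) «LI B18 KERNEL» ×6 = Q1 `LiRephasingGainBudget` → Q2 `LiOneStepRephasing` → Q3 `LiRephasingSchedule` →
Q4 `LiRephasingScales` → Q5 `LiRephasingMovingCutPrelim` → Q6 `LiRephasingMovingCut` RESERVED by RULING #204 (rh-split lead g6,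
2026-08-27T18:03:10Z): GO = (xi-p) `LiRephasingKit` ACCEPTED (p553624, 18:01:43Z) + referee g8 BYTES and negctl replay on the six carved shas;
LOWEST priority; filing words `--supports stmt-RiemannHypothesis-19649 --as helper`, kind auto, parts land in chain order.  Cell rh-split,
seat rh-split-li-bridge (kernel author g16, cutter g17; brief sha16 f79c5f09d8bcb036), card `run/shared/lean/pub/rh-split/cards/SPLIT-li-bridge.md`
§23 / 23.8 (model barrier B18 «INCREMENT-LEVEL RE-PHASING ⟂ COUNTING-LAW BRIDGES»).  Kernel source `HOME/rh-split-li-bridge/SketchG16B.lean`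
sha16 cf2b65fdbda323e2 (1639 l, ns `RhSplit.LiBridgeG16`, farm rc 0 · 0 err · 0 warn · 0 sorry, std axioms; §§1–6 = `SketchG16.lean`
355f955084e6fc2c byte-identical prefix, referee REPLAY PASS 17:02Z / RULING #176; §§7–9 referee REPLAY PASS 17:28:47Z / RULING #186);
cut plan `CARVE-16.md` 677f9696f1bd3382; reconstruction note `HOME/rh-split-li-bridge/carve-16/README.md` (CUT ONLY — no regeneration).
THIS PART = scratch ll.1428–1637 (§9 from `structure ScaleDataPL` to the end)
↦ ll.55–264 here; decl text BYTE-VERBATIM (statements AND proofs, scratch section headers kept).  Deltas = namespace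
`RhSplit.LiBridgeG16` ↦ `Summit.RiemannHypothesis.RiemannHypothesis.Theorems.Splittings.LiRephasingMovingCut`, imports (Q5 `…Splittings.LiRephasingMovingCutPrelim` + HarnessLib),
this header, `set_option linter.dupNamespace false`, the `open` lines (the scratch's + `…Splittings.LiRephasingKit` + the earlier parts'
namespaces).  The six SketchG15B lemmas of scratch §1 (`exists_sin_eq_neg_one_of_phase_drop`, `four_sin_half_mul_sin`,
`sum_range_phase_telescope`, `abs_sum_range_phase_le`, `abs_sum_range_family_le`, `exists_le_on_block`) are CITED from the tree's
`LiRephasingKit` (lane (xi-p)), never restated.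

Content: §9 (second part) `ScaleDataPL`/`scaleDataPL`, `TseqPL`, `sdPL` (+ `_N_pos`, `_N_one_le`), **`mkSchedulePL`** (+ `_dec`, `_N_ge`),
**`theoremA_infty_PL`** and **`rephasing_kills_lowPhaseLaw`**: for every sparsity sequence `m_k ≥ 1` ONE assignment `g = S.glim` of
ordinates to the true zeros — each moved at most once, downward, by less than `(2π/log γ)/16` and `≤ 1`, only every `m_k`-th zero of
zone `k`, counting function within one unit window of the truth — has, for EVERY `K`, `¬ ∀ᶠ n, K − ½ log n ≤ lowSumRe g n (√n · log n)`:
the cell's `LowPhaseLaw K`-shaped floor fails for the re-phased configuration.  B18 END-TO-END for Γ_ζ, RH-free; it says NOTHING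
about `lowSum` itself, PL, K7ev or RH.  1 structure, 4 defs, 6 theorems.

HONEST LABEL: SPLITTING SEARCH over kernel-typed RH-EQUIVALENCES; a splitting A ∧ B ⟹ RH is CONDITIONAL bookkeeping
unless A and B are both proved; nothing here bears on the truth of RH.  Every theorem below is PURE (trigonometry /
finite sums / calculus / parameter arithmetic) or RH-FREE (about the true zeta zeros, no hypothesis on their real parts);
none is a claim about RH, PL or K7ev; the whole chain is BARRIER-SIDE bookkeeping (B18), not a conjunct toward RH.
-/

set_option linter.dupNamespace false

namespace Summit.RiemannHypothesis.RiemannHypothesis.Theorems.Splittings.LiRephasingMovingCut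

open Real Set Finset
open Literature.NumberTheory.LFunctions Literature.NumberTheory.LFunctions.SchoenfeldBound
open Literature.NumberTheory.LFunctions.AlpogeFurman2026
open Literature.NumberTheory.LFunctions.SoundTest
open Summit.RiemannHypothesis.RiemannHypothesis.Theorems.LiTheory
open Summit.RiemannHypothesis.RiemannHypothesis.Theorems.Splittings
open Summit.RiemannHypothesis.RiemannHypothesis.Theorems.Splittings.LiIncrHighPart
open Summit.RiemannHypothesis.RiemannHypothesis.Theorems.Splittings.LiRephasingKit
open Summit.RiemannHypothesis.RiemannHypothesis.Theorems.Splittings.LiRephasingGainBudget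
open Summit.RiemannHypothesis.RiemannHypothesis.Theorems.Splittings.LiOneStepRephasing
open Summit.RiemannHypothesis.RiemannHypothesis.Theorems.Splittings.LiRephasingSchedule
open Summit.RiemannHypothesis.RiemannHypothesis.Theorems.Splittings.LiRephasingScales
open Summit.RiemannHypothesis.RiemannHypothesis.Theorems.Splittings.LiRephasingMovingCutPrelim

/-- The data of one scale with the moving cut (from `exists_scale_PL`). -/
structure ScaleDataPL (T : ℝ) (m : ℕ) (K : ℝ) where
  /-- zone exponent -/
  J : ℕ
  /-- block start -/
  N : ℕ
  hJ : 2 ≤ J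
  hNbig : (3072 : ℝ) ^ 4 ≤ N
  hreach : 16 * π * (2 ^ J * T) ≤ (N : ℝ)
  hdec : 32 * (2 ^ J * T) ^ 2 * Real.log (2 ^ J * T) ≤ (N : ℝ)
  htop : 2 ^ J * T ≤ Real.sqrt N * Real.log N
  hbudget : 13 * m * ((Real.log (2 * N) / 2 - K + 1 + 2 / (Real.sqrt N * Real.log N) *
          (3 * (Real.sqrt (2 * N) * Real.log (2 * N) + 1) *
            Real.log (Real.sqrt (2 * N) * Real.log (2 * N) + 3))) +
        4 * (∑ ρ ∈ zerosBetween 0 (Real.sqrt N * Real.log N), mult ρ) / N) ≤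
        J * Real.log (T / (2 * π)) + Real.log 2 * (J * (J - 1) / 2)

/-- A choice of moving-cut scale data above the floor `T`. -/
noncomputable def scaleDataPL {T : ℝ} (hT : 260 ≤ T) {m : ℕ} (hm : 0 < m) (K : ℝ) : ScaleDataPL T m K :=
  let h := exists_scale_PL hT hm K
  ⟨h.choose, h.choose_spec.choose, h.choose_spec.choose_spec.1, h.choose_spec.choose_spec.2.1,
    h.choose_spec.choose_spec.2.2.1, h.choose_spec.choose_spec.2.2.2.1, h.choose_spec.choose_spec.2.2.2.2.1,
    h.choose_spec.choose_spec.2.2.2.2.2⟩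

/-- The zone floors for the moving cut: `T_0 = 260`, `T_{k+1} = √(2N_k) log(2N_k) = Y_{2N_k}`. -/
noncomputable def TseqPL (mseq : ℕ → ℕ) (hm : ∀ k, 0 < mseq k) (Kseq : ℕ → ℝ) : ℕ → {T : ℝ // 260 ≤ T}
  | 0 => ⟨260, le_rfl⟩
  | k + 1 =>
    ⟨Real.sqrt (2 * (scaleDataPL (TseqPL mseq hm Kseq k).2 (hm k) (Kseq k)).N) *
        Real.log (2 * (scaleDataPL (TseqPL mseq hm Kseq k).2 (hm k) (Kseq k)).N),
      next_floor_ge (scaleDataPL (TseqPL mseq hm Kseq k).2 (hm k) (Kseq k)).hNbig⟩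

/-- Scale data of scale `k`. -/
noncomputable def sdPL (mseq : ℕ → ℕ) (hm : ∀ k, 0 < mseq k) (Kseq : ℕ → ℝ) (k : ℕ) :
    ScaleDataPL (TseqPL mseq hm Kseq k).1 (mseq k) (Kseq k) :=
  scaleDataPL (TseqPL mseq hm Kseq k).2 (hm k) (Kseq k)

/-- The moving-cut scale data have positive sample size: `0 < (sdPL …).N`. PURE. -/
theorem sdPL_N_pos (mseq : ℕ → ℕ) (hm : ∀ k, 0 < mseq k) (Kseq : ℕ → ℝ) (k : ℕ) :
    0 < (sdPL mseq hm Kseq k).N := by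
  have h := (sdPL mseq hm Kseq k).hNbig
  have : (0 : ℝ) < (sdPL mseq hm Kseq k).N := lt_of_lt_of_le (by norm_num) h
  exact_mod_cast this

/-- `1 ≤ (sdPL …).N` (real cast of `sdPL_N_pos`). PURE. -/
theorem sdPL_N_one_le (mseq : ℕ → ℕ) (hm : ∀ k, 0 < mseq k) (Kseq : ℕ → ℝ) (k : ℕ) :
    (1 : ℝ) ≤ (sdPL mseq hm Kseq k).N := by
  exact_mod_cast sdPL_N_pos mseq hm Kseq k

/-- **THE MOVING-CUT SCHEDULE**: cut `Y_k = √N_k log N_k`, floor `−A_k`,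
`A_k = ½ log 2N_k − K_k + 1 + (2/Y_k)·3(Y_{2N_k}+1)log(Y_{2N_k}+3)`. -/
noncomputable def mkSchedulePL (mseq : ℕ → ℕ) (hm : ∀ k, 0 < mseq k) (Kseq : ℕ → ℝ) : Schedule where
  N k := (sdPL mseq hm Kseq k).N
  T k := (TseqPL mseq hm Kseq k).1
  J k := (sdPL mseq hm Kseq k).J
  m := mseq
  Y k := Real.sqrt (sdPL mseq hm Kseq k).N * Real.log (sdPL mseq hm Kseq k).N
  A k := Real.log (2 * (sdPL mseq hm Kseq k).N) / 2 - Kseq k + 1 +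
    2 / (Real.sqrt (sdPL mseq hm Kseq k).N * Real.log (sdPL mseq hm Kseq k).N) *
      (3 * (Real.sqrt (2 * (sdPL mseq hm Kseq k).N) * Real.log (2 * (sdPL mseq hm Kseq k).N) + 1) *
        Real.log (Real.sqrt (2 * (sdPL mseq hm Kseq k).N) * Real.log (2 * (sdPL mseq hm Kseq k).N) + 3))
  hT k := (TseqPL mseq hm Kseq k).2
  hY k := (sdPL mseq hm Kseq k).htop
  hsep k := by
    show Real.sqrt ((sdPL mseq hm Kseq k).N : ℝ) * Real.log ((sdPL mseq hm Kseq k).N : ℝ) ≤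
      Real.sqrt (2 * ((sdPL mseq hm Kseq k).N : ℝ)) * Real.log (2 * ((sdPL mseq hm Kseq k).N : ℝ))
    exact sqrt_mul_log_mono (sdPL_N_one_le mseq hm Kseq k) (by linarith [sdPL_N_one_le mseq hm Kseq k])
  hm := hm
  hN k := sdPL_N_pos mseq hm Kseq k
  hreach k := (sdPL mseq hm Kseq k).hreach
  hbudget k := (sdPL mseq hm Kseq k).hbudget

/-- The moving-cut schedule meets the decay-size condition `32 (2^J T)^2 log(2^J T) ≤ N` at every step. PURE. -/
theorem mkSchedulePL_dec (mseq : ℕ → ℕ) (hm : ∀ k, 0 < mseq k) (Kseq : ℕ → ℝ) (k : ℕ) :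
    32 * (2 ^ ((mkSchedulePL mseq hm Kseq).J k) * (mkSchedulePL mseq hm Kseq).T k) ^ 2 *
        Real.log (2 ^ ((mkSchedulePL mseq hm Kseq).J k) * (mkSchedulePL mseq hm Kseq).T k) ≤
      ((mkSchedulePL mseq hm Kseq).N k : ℝ) :=
  (sdPL mseq hm Kseq k).hdec

/-- The moving-cut schedule's sample sizes grow at least like `260 · 4^k`. PURE. -/
theorem mkSchedulePL_N_ge (mseq : ℕ → ℕ) (hm : ∀ k, 0 < mseq k) (Kseq : ℕ → ℝ) (k : ℕ) :
    260 * 4 ^ k ≤ ((mkSchedulePL mseq hm Kseq).N k : ℝ) := by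
  set S := mkSchedulePL mseq hm Kseq with hS
  -- `T_k ≥ 260·4^k` by induction (`T_{k+1} ≥ Y_k ≥ 2^{J_k} T_k ≥ 4 T_k`), and `N_k ≥ 16π·2^{J_k} T_k ≥ T_k`
  have hT : ∀ k, 260 * 4 ^ k ≤ S.T k := by
    intro k
    induction k with
    | zero => show (260 : ℝ) * 4 ^ 0 ≤ 260; norm_num
    | succ k ih =>
      have hJ : 2 ≤ S.J k := (sdPL mseq hm Kseq k).hJ
      have h4 : (4 : ℝ) ≤ 2 ^ S.J k := by
        calc (4 : ℝ) = 2 ^ 2 := by norm_num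
          _ ≤ _ := pow_le_pow_right₀ (by norm_num) hJ
      have h1 : (2 : ℝ) ^ S.J k * S.T k ≤ S.T (k + 1) := (S.hY k).trans (S.hsep k)
      have hT0 : (0 : ℝ) ≤ 260 * 4 ^ k := by positivity
      calc (260 : ℝ) * 4 ^ (k + 1) = 4 * (260 * 4 ^ k) := by ring
        _ ≤ 2 ^ S.J k * S.T k := mul_le_mul h4 ih hT0 (by positivity)
        _ ≤ S.T (k + 1) := h1
  have h2 := S.hreach k
  have h3 : S.T k ≤ 16 * π * (2 ^ (S.J k) * S.T k) := by
    have := S.T_le_top k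
    nlinarith [Real.pi_gt_three, S.T_pos k]
  linarith [hT k]

/-- **THEOREM A∞ WITH THE PÓLYA–LANDAU CUT (KERNEL, RH-FREE).**  For every sparsity sequence `m_k ≥ 1` and floor sequence
`K_k` there is a schedule with these sparsities whose limiting re-phasing `glim` (identity off the zones; inside zone `k`
only every `m_k`-th zero moves, DOWNWARD, by `≤ (2π/log γ)/16` and `≤ 1`; counting function within `3 log(t+2)` of
the truth) makes the re-phased low phase sum AT THE MOVING CUT `Y_n = √n log n` drop below `K_k − ½ log n` at some
`n ∈ [N_k, 2N_k)`, `N_k ≥ 260·4^k`. -/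
theorem theoremA_infty_PL (mseq : ℕ → ℕ) (hm : ∀ k, 0 < mseq k) (Kseq : ℕ → ℝ) :
    ∃ S : Schedule, S.m = mseq ∧ (∀ k, 260 * 4 ^ k ≤ (S.N k : ℝ)) ∧
      (∀ Y t, 0 ≤ t → countRe (fun ρ ↦ ρ.im) Y t ≤ countRe S.glim Y t ∧
        countRe S.glim Y t ≤ countRe (fun ρ ↦ ρ.im) Y t + 3 * Real.log (t + 2)) ∧
      (∀ k ρ, ρ ∈ S.zone k →
        ρ.im - 2 * π / Real.log ρ.im / 16 ≤ S.glim ρ ∧ ρ.im - 1 ≤ S.glim ρ ∧ S.glim ρ ≤ ρ.im) ∧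
      (∀ ρ, (∀ k, ρ ∉ S.zone k) → S.glim ρ = ρ.im) ∧
      (∀ k, ∃ c < mseq k, ∀ ρ ∈ S.zone k, ρ ∉ sel (S.zone k) (mseq k) c → S.glim ρ = ρ.im) ∧
      ∀ k, ∃ n ∈ Finset.Ico (S.N k) (2 * S.N k),
        lowSumRe S.glim n (Real.sqrt n * Real.log n) < Kseq k - Real.log n / 2 := by
  set S := mkSchedulePL mseq hm Kseq with hS
  refine ⟨S, rfl, mkSchedulePL_N_ge mseq hm Kseq,
    fun Y t ht ↦ S.glim_count (mkSchedulePL_dec mseq hm Kseq) Y ht,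
    fun k ρ hρ ↦ S.glim_moved_spacing (mkSchedulePL_dec mseq hm Kseq) hρ,
    fun ρ h ↦ S.glim_eq_im h, fun k ↦ S.glim_sparse k, fun k ↦ ?_⟩
  obtain ⟨n, hn, hle⟩ := S.chain_violates k
  refine ⟨n, hn, ?_⟩
  obtain ⟨h1, h2⟩ := Finset.mem_Ico.1 hn
  -- names
  have hNdef : S.N k = (sdPL mseq hm Kseq k).N := rfl
  set Nk : ℕ := (sdPL mseq hm Kseq k).N with hNk
  have hN1 : (1 : ℝ) ≤ Nk := sdPL_N_one_le mseq hm Kseq k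
  have hNbig : (3072 : ℝ) ^ 4 ≤ Nk := (sdPL mseq hm Kseq k).hNbig
  have hYdef : S.Y k = Real.sqrt Nk * Real.log Nk := rfl
  have hT1 : S.T (k + 1) = Real.sqrt (2 * Nk) * Real.log (2 * Nk) := rfl
  have hA : S.A k = Real.log (2 * Nk) / 2 - Kseq k + 1 +
      2 / (Real.sqrt Nk * Real.log Nk) *
        (3 * (Real.sqrt (2 * Nk) * Real.log (2 * Nk) + 1) *
          Real.log (Real.sqrt (2 * Nk) * Real.log (2 * Nk) + 3)) := rfl
  rw [hNdef] at h1 h2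
  have hn1 : (Nk : ℝ) ≤ n := by exact_mod_cast h1
  have hn2 : (n : ℝ) ≤ 2 * Nk := by exact_mod_cast h2.le
  have hn0 : (0 : ℝ) < n := by linarith
  -- the cut `Y_n` lies between `Y_k = Y_{N_k}` and `T_{k+1} = Y_{2N_k}`
  have hYle : S.Y k ≤ Real.sqrt n * Real.log n := by rw [hYdef]; exact sqrt_mul_log_mono hN1 hn1
  have hcut_le : Real.sqrt n * Real.log n ≤ S.T (k + 1) := by
    rw [hT1]; exact sqrt_mul_log_mono (by linarith) hn2
  have hY0 : 0 < S.Y k := lt_of_lt_of_le (S.T_pos k) ((S.T_le_top k).trans (S.hY k))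
  -- zeros between the two cuts are untouched
  have hg : ∀ ρ ∈ zerosBetween (S.Y k) (Real.sqrt n * Real.log n), S.Y k ≤ S.glim ρ := by
    intro ρ hρ
    have hm' := (mem_zerosBetween hY0.le).1 hρ
    have hno := S.not_mem_zone_of_gap hm'.2.2.2.1 (hm'.2.2.2.2.trans hcut_le)
    rw [S.glim_eq_im hno]
    exact hm'.2.2.2.1.le
  have hcut := lowSumRe_cut_le S.glim n hY0 hYle hg
  -- the drift is paid from `A_k`
  have hsub : ∑ ρ ∈ zerosBetween (S.Y k) (Real.sqrt n * Real.log n), mult ρ ≤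
      ∑ ρ ∈ zerosBetween 0 (S.T (k + 1)), mult ρ := by
    apply Finset.sum_le_sum_of_subset_of_nonneg
    · intro ρ hρ
      have hm' := (mem_zerosBetween hY0.le).1 hρ
      exact (mem_zerosBetween le_rfl).2
        ⟨hm'.1, hm'.2.1, hm'.2.2.1, by linarith [hm'.2.2.2.1], hm'.2.2.2.2.trans hcut_le⟩
    · intro ρ hρ _
      exact LiLowZeroBudget.mult_nonneg le_rfl hρ
  have hT10 : 0 ≤ S.T (k + 1) := (S.T_pos (k + 1)).le
  have hcount := count_le' hT10
  rw [hT1] at hcount hsub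
  have hY0' : 0 ≤ 2 / S.Y k := by positivity
  have hdrift : 2 / S.Y k * ∑ ρ ∈ zerosBetween (S.Y k) (Real.sqrt n * Real.log n), mult ρ ≤
      2 / S.Y k * (3 * (Real.sqrt (2 * Nk) * Real.log (2 * Nk) + 1) *
        Real.log (Real.sqrt (2 * Nk) * Real.log (2 * Nk) + 3)) :=
    mul_le_mul_of_nonneg_left (hsub.trans hcount) hY0'
  rw [hYdef] at hdrift hcut hle
  rw [hA] at hle
  have hlog : Real.log n ≤ Real.log (2 * Nk) := Real.log_le_log hn0 hn2
  linarith

/-- **COROLLARY — the re-phased `LowPhaseLaw` fails for EVERY `K` (B18, moving cut, kernel).**  With `K_k = −k`: ONE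
re-phasing of the true zeta ordinates — invisible to every counting law of resolution `≥ 3 log(t+2)`, moving only a
`(1/m_k)`-sparse class of zone `k`, each zero by `≤ spacing/16` — satisfies, for every `K` and every `n₀`,
`lowSumRe g n (√n log n) < K − ½ log n` for some `n ≥ n₀`; in filter language `¬ ∀ᶠ n, K − ½ log n ≤ lowSumRe g n (Y_n)`,
i.e. the re-phased analogue of `LowPhaseLaw K` is false for all `K`. RH-FREE. -/
theorem rephasing_kills_lowPhaseLaw (mseq : ℕ → ℕ) (hm : ∀ k, 0 < mseq k) :
    ∃ S : Schedule, S.m = mseq ∧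
      (∀ Y t, 0 ≤ t → countRe (fun ρ ↦ ρ.im) Y t ≤ countRe S.glim Y t ∧
        countRe S.glim Y t ≤ countRe (fun ρ ↦ ρ.im) Y t + 3 * Real.log (t + 2)) ∧
      (∀ k ρ, ρ ∈ S.zone k →
        ρ.im - 2 * π / Real.log ρ.im / 16 ≤ S.glim ρ ∧ ρ.im - 1 ≤ S.glim ρ ∧ S.glim ρ ≤ ρ.im) ∧
      (∀ ρ, (∀ k, ρ ∉ S.zone k) → S.glim ρ = ρ.im) ∧
      (∀ k, ∃ c < mseq k, ∀ ρ ∈ S.zone k, ρ ∉ sel (S.zone k) (mseq k) c → S.glim ρ = ρ.im) ∧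
      (∀ K : ℝ, ∀ n₀ : ℕ, ∃ n ≥ n₀, lowSumRe S.glim n (Real.sqrt n * Real.log n) < K - Real.log n / 2) ∧
      ∀ K : ℝ, ¬ ∀ᶠ n : ℕ in Filter.atTop, K - Real.log n / 2 ≤ lowSumRe S.glim n (Real.sqrt n * Real.log n) := by
  obtain ⟨S, h1, h2, h3, h4, h5, h6, h7⟩ := theoremA_infty_PL mseq hm (fun k ↦ -(k : ℝ))
  have key : ∀ K : ℝ, ∀ n₀ : ℕ, ∃ n ≥ n₀, lowSumRe S.glim n (Real.sqrt n * Real.log n) < K - Real.log n / 2 := by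
    intro K n₀
    set k := max n₀ ⌈-K⌉₊ with hk
    obtain ⟨n, hn, hlt⟩ := h7 k
    obtain ⟨hn1, -⟩ := Finset.mem_Ico.1 hn
    have hNk := h2 k
    have h4k : (k : ℝ) < 4 ^ k := by exact_mod_cast Nat.lt_pow_self (by norm_num : 1 < 4)
    have hkn : n₀ ≤ n := by
      have : (k : ℝ) ≤ n := by
        have : (S.N k : ℝ) ≤ n := by exact_mod_cast hn1
        linarith
      have hk0 : n₀ ≤ k := le_max_left _ _
      exact_mod_cast (show (n₀ : ℝ) ≤ n from le_trans (by exact_mod_cast hk0) this)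
    refine ⟨n, hkn, lt_of_lt_of_le hlt ?_⟩
    have : -K ≤ (k : ℝ) := (Nat.le_ceil (-K)).trans (by exact_mod_cast le_max_right _ _)
    linarith
  refine ⟨S, h1, h3, h4, h5, h6, key, fun K hK ↦ ?_⟩
  obtain ⟨n₀, hn₀⟩ := Filter.eventually_atTop.1 hK
  obtain ⟨n, hn, hlt⟩ := key K n₀
  exact absurd (hn₀ n hn) (not_le.2 hlt)

end Summit.RiemannHypothesis.RiemannHypothesis.Theorems.Splittings.LiRephasingMovingCut
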